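import Literature.Dynamics.NBody.AlbouyKaloshin2012SymmetricCCsAll
import Literature.Dynamics.NBody.Moulton1910Collinear

/-!
# Reflection-symmetric central configurations of `(1,1,b,b,c)`: the Moulton hypothesis discharged

Topic `Literature/Dynamics/NBody`; `pub-smale6` cell, seat 1 gen 3. `AlbouyKaloshin2012SymmetricCCsAll.lean` proves that
the reflection-symmetric positive normalized central configurations ([AlbouyKaloshin2012] Definition 1) of the masses
`(1,1,b,b,c)` are finite in number GIVEN (i) finiteness of the collinear ones (Moulton 1910) and (ii) finiteness of the
real solution sets of the three polynomial slice systems `T12 (++++), T12 (+++−), T1234 (++)` (at `(b,c)` and at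
`(b⁻¹, c b⁻¹)`). `Moulton1910Collinear.lean` now proves (i) (`collinear_positiveNormalizedCCs_finite`), so the statements
below carry only the hypotheses (ii) — exactly the zero-dimensionality questions that the cell's certified / modular
Gröbner computations address (HOME `certs/modgb/`). For the Roberts masses `(1,1,1,1,1/4)` ([AlbouyKaloshin2012]
Remark 8 p. 583, [Roberts1999]) three systems remain: `roberts_fourTypes_finite'`.
-/

namespace Literature.Dynamics.NBody

/-- The masses `(1,1,b,b,c)` with `b, c > 0` are positive. [folklore] -/
theorem e32Masses_pos {b c : ℝ} (hb : 0 < b) (hc : 0 < c) : ∀ k, 0 < e32Masses b c k := by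
  intro k
  fin_cases k <;> simp [e32Masses] <;> assumption

/-- Moulton for `(1,1,b,b,c)`: the collinear (on the `x`-axis) positive normalized central configurations are finite in
number. [cite: Moulton1910, §5] -/
theorem collinearXCCs_e32_finite {b c : ℝ} (hb : 0 < b) (hc : 0 < c) :
    (collinearXCCs (e32Masses b c)).Finite :=
  collinear_positiveNormalizedCCs_finite (e32Masses_pos hb hc)

/-- All reflection-symmetric positive normalized central configurations of `(1,1,b,b,c)` (`b, c > 0`, `b ≠ 1`, `c ≠ 1`,
`b ≠ c`) are finite in number as soon as the five slice-system solution sets are finite — the Moulton hypothesis of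
`reflSymmCCs_finite` is discharged by `Moulton1910Collinear`. [cite: AlbouyKaloshin2012, Proposition 7 p. 572; Remark 8 p. 583] -/
theorem reflSymmCCs_finite' {b c : ℝ} (hb : 0 < b) (hc : 0 < c) (hb1 : b ≠ 1) (hc1 : c ≠ 1) (hbc : b ≠ c)
    (hA : (t12BranchSet 1 1 1 1 b c).Finite) (hB : (t12BranchSet 1 1 1 (-1) b c).Finite)
    (hA' : (t12BranchSet 1 1 1 1 b⁻¹ (c * b⁻¹)).Finite)
    (hB' : (t12BranchSet 1 1 1 (-1) b⁻¹ (c * b⁻¹)).Finite)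
    (hC : (t1234BranchSet 1 1 b c).Finite) : (reflSymmCCs (e32Masses b c)).Finite :=
  reflSymmCCs_finite hb hb1 hc1 hbc (by linarith) (collinearXCCs_e32_finite hb hc) hA hB hA' hB' hC

/-- **Roberts masses `(1,1,1,1,1/4)`.** The positive normalized central configurations with a reflection symmetry of
one of the four types id, (1 2), (3 4), (1 2)(3 4) are finite in number provided the real solution sets of the three
slice systems `T12(1,1/4)` on the branches `++++`, `+++−` and `T1234(1,1/4)` on `++` are finite (Moulton's collinear
finiteness is now a theorem, not a hypothesis). [cite: AlbouyKaloshin2012, Remark 8 p. 583] -/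
theorem roberts_fourTypes_finite'
    (hA : (t12BranchSet 1 1 1 1 1 (1 / 4)).Finite) (hB : (t12BranchSet 1 1 1 (-1) 1 (1 / 4)).Finite)
    (hC : (t1234BranchSet 1 1 1 (1 / 4)).Finite) :
    (reflSymmIdCCs 1 (1 / 4) ∪ reflSymm12CCs 1 (1 / 4) ∪ reflSymm34CCs 1 (1 / 4) ∪
      reflSymm1234CCs 1 (1 / 4)).Finite :=
  roberts_fourTypes_finite (collinearXCCs_e32_finite one_pos (by norm_num)) hA hB hC

end Literature.Dynamics.NBody
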